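import Summits.AnomalousDissipation.AnomalousDissipation.Theorems.NeutralTaylorWavesTaylorWaveQuasiSteadyHierarchy
import Literature.Analysis.FunctionSpaces.TorusTestFunction
import Mathlib.Tactic.Module
import Mathlib.Tactic.FieldSimp

/-!
# Stub `stub_formalExpansionW` of the line `windfibred` (rev 3)
# (crux stmt-AnomalousDissipation-16293, `NeutralTaylorWaves.TaylorWaveQuasiSteady`)

**Formal Laurent expansion on the polynomial ansatz** (the registered signature, verbatim, is the last theorem).
On `T⁴ = T³ × T¹` the two-scale operators of the Line file (`tsDeriv ε j G i = ∂_{xᵢ} + ε⁻¹ kᵢ ∂_θ`, `tsDiv`,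
`tsConvect`, `tsLaplacian`, `tsGrad`, `tsResidual`) are Laurent polynomials in `ε`; on the truncated sums
`P = ∑_{a<N+1} ε^a Pₐ`, `Q = ∑_{a<N+1} ε^a Qₐ`, `c = ∑_{a<N+1} ε^a cₐ` one gets, for `ε ≠ 0`,
`ε · tsDiv ε P = ∑_{s<N+2} ε^s d_s` and `ε · tsResidual ε P Q c = ∑_{s<2N+4} ε^s M_s` with the ε-FREE profiles
`d_s = divCoeff j G N P s`, `M_s = hierarchyCoeff j G f N P Q c s` of the vocabulary file
`NeutralTaylorWavesTaylorWaveQuasiSteadyHierarchy` (written with `sDeriv i = ∂_{xᵢ}`, `fDeriv j G i = kᵢ(x) ∂_θ`).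
This is pure algebra plus linearity of `∂ₘ` on smooth functions:

* §1 regrouping `∑_s ε^s ∑_a [g a = s] Xₐ = ∑_a ε^{g a} Xₐ` (`Finset.sum_comm`, `Finset.sum_ite_eq`), one/two indices;
* §2 `tsDeriv = sDeriv + ε⁻¹ • fDeriv`, smoothness and linearity of `sDeriv`, `fDeriv` (tree:
  `Torus.partialDeriv_add/_const_smul`, `IsSmooth.partialDeriv`, `ResidualTransfer.isSmooth_comp_slow`,
  `DissipationLaw.isSmooth_phaseGrad`), whence the mode-by-mode expansions of `tsLaplacian` (second order: the inner
  `D^ε_i Φ` is rewritten as the smooth function `sDeriv i Φ + ε⁻¹ • fDeriv i Φ`; mixed terms stay compositions) and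
  of `tsConvect`;
* §3 linearity of all two-scale operators over the ansatz `∑ ε^a Xₐ` (tree: `Torus.partialDeriv_finset_sum`,
  `ResidualTransfer.isSmooth_tsDeriv` for the iterated derivative);
* §4 the five pieces of `ε · tsResidual` (convection, viscosity `ε · ε²·`, pressure, drift, force) and the divergence,
  each equal to `∑_s ε^s ·` (its block of `M_s`, resp. `d_s`): expand, regroup, and close summand-wise by
  `match_scalars`/`field_simp`/`ring` (`ε ≠ 0` only enters through `ε · ε⁻¹ = 1`);
* §5 the registered stub: smoothness of the truncated sums (`ContDiff.sum`), `∂ₘ ∑ = ∑ ∂ₘ`, and the two expansions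
  (`tsResidual`, `hierarchyCoeff` unfolded and split with `smul_sub`, `Finset.sum_sub_distrib`).

Source: folklore (BKW/WKB bookkeeping for monophase profiles `U(x, φ(x)/ε)`; Cheverry–Guès–Métivier,
Ann. Sci. ENS 36 (2003) §2; Cheverry, Bull. SMF 134 (2006) §2).
-/

-- `Summit.<Summit>.<Problem>` is the tree's mandated summit-side namespace (CONVENTIONS §2); for this
-- single-conjunct summit the two coincide, so the duplicate is deliberate.
set_option linter.dupNamespace false

noncomputable section

open scoped BigOperators Topology InnerProductSpace ContDiff
open Filter MeasureTheory
open Literature.Analysis.FunctionSpaces Literature.Analysis.FunctionSpaces.Torus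

namespace Summit.AnomalousDissipation.AnomalousDissipation.Theorems.TaylorWaveQuasiSteady.FormalExpansion

open Summit.AnomalousDissipation.AnomalousDissipation.Theorems.TaylorWaveQuasiSteady

variable {F : Type*} [NormedAddCommGroup F] [NormedSpace ℝ F]

/-! ## §1 Regrouping finite Laurent sums by powers of `ε` -/

section Regroup

variable {M : Type*} [AddCommMonoid M] [Module ℝ M]

/-- Regrouping by powers of `ε`, one index: if `g a < S` on `T`, then
`∑_{s<S} ε^s ∑_{a ∈ T} [g a = s] X a = ∑_{a ∈ T} ε^{g a} X a`. [folklore] -/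
theorem sum_pow_smul_sum_ite (ε : ℝ) {S : ℕ} (T : Finset ℕ) (g : ℕ → ℕ) (X : ℕ → M)
    (hg : ∀ a ∈ T, g a < S) :
    ∑ s ∈ Finset.range S, ε ^ s • ∑ a ∈ T, (if g a = s then X a else 0) = ∑ a ∈ T, ε ^ g a • X a := by
  simp_rw [Finset.smul_sum, smul_ite, smul_zero]
  rw [Finset.sum_comm]
  refine Finset.sum_congr rfl fun a ha => ?_
  rw [Finset.sum_ite_eq, if_pos (Finset.mem_range.2 (hg a ha))]

/-- Regrouping by powers of `ε`, two indices: if `g a b < S` on `T × T`, then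
`∑_{s<S} ε^s ∑_{a,b ∈ T} [g a b = s] X a b = ∑_{a,b ∈ T} ε^{g a b} X a b`. [folklore] -/
theorem sum_pow_smul_sum_sum_ite (ε : ℝ) {S : ℕ} (T : Finset ℕ) (g : ℕ → ℕ → ℕ) (X : ℕ → ℕ → M)
    (hg : ∀ a ∈ T, ∀ b ∈ T, g a b < S) :
    ∑ s ∈ Finset.range S, ε ^ s • ∑ a ∈ T, ∑ b ∈ T, (if g a b = s then X a b else 0) =
      ∑ a ∈ T, ∑ b ∈ T, ε ^ g a b • X a b := by
  simp_rw [Finset.smul_sum, smul_ite, smul_zero]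
  rw [Finset.sum_comm]
  refine Finset.sum_congr rfl fun a ha => ?_
  rw [Finset.sum_comm]
  refine Finset.sum_congr rfl fun b hb => ?_
  rw [Finset.sum_ite_eq, if_pos (Finset.mem_range.2 (hg a ha b hb))]

/-- `r • ∑_{x < n} u x = ∑_{x < n} r • u x`: `Finset.smul_sum` restricted to `range` sums, so that as a `simp`
lemma it leaves the coordinate sums over `Fin 3` untouched. [folklore] -/
theorem smul_sum_range (r : ℝ) (n : ℕ) (u : ℕ → M) :
    r • ∑ x ∈ Finset.range n, u x = ∑ x ∈ Finset.range n, r • u x :=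
  Finset.smul_sum

omit [Module ℝ M] in
/-- `∑_{x < n} (u x + v x) = ∑_{x < n} u x + ∑_{x < n} v x`: `Finset.sum_add_distrib` restricted to `range` sums
(same purpose as `smul_sum_range`). [folklore] -/
theorem sum_range_add (n : ℕ) (u v : ℕ → M) :
    ∑ x ∈ Finset.range n, (u x + v x) = ∑ x ∈ Finset.range n, u x + ∑ x ∈ Finset.range n, v x :=
  Finset.sum_add_distrib

end Regroup

/-- Regrouping by powers of `ε`, one index, real-valued (`*` for `•`). [folklore] -/
theorem sum_pow_mul_sum_ite (ε : ℝ) {S : ℕ} (T : Finset ℕ) (g : ℕ → ℕ) (X : ℕ → ℝ)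
    (hg : ∀ a ∈ T, g a < S) :
    ∑ s ∈ Finset.range S, ε ^ s * ∑ a ∈ T, (if g a = s then X a else 0) = ∑ a ∈ T, ε ^ g a * X a := by
  simpa only [smul_eq_mul] using sum_pow_smul_sum_ite ε T g X hg

/-! ## §2 The two-scale derivative as `sDeriv + ε⁻¹ • fDeriv`; linearity of `sDeriv`, `fDeriv` -/

/-- `D^ε_i Φ = ∂_{xᵢ} Φ + ε⁻¹ kᵢ ∂_θ Φ`, i.e. `tsDeriv = sDeriv + ε⁻¹ • fDeriv` pointwise. [folklore] -/
theorem tsDeriv_eq (ε : ℝ) (j : Fin 3 → ℤ) (G : UnitAddTorus (Fin 3) → ℝ) (i : Fin 3)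
    (Φ : UnitAddTorus (Fin 4) → F) (y : UnitAddTorus (Fin 4)) :
    tsDeriv ε j G i Φ y = sDeriv i Φ y + ε⁻¹ • fDeriv j G i Φ y := by
  simp only [tsDeriv, sDeriv, fDeriv, mul_smul]

/-- Slow derivatives of smooth profiles are smooth. [folklore] -/
theorem isSmooth_sDeriv {Φ : UnitAddTorus (Fin 4) → F} (hΦ : IsSmooth Φ) (i : Fin 3) : IsSmooth (sDeriv i Φ) :=
  hΦ.partialDeriv i.castSucc

/-- Weighted fast derivatives `kᵢ(x) ∂_θ Φ` of smooth profiles are smooth (for smooth `G`). [folklore] -/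
theorem isSmooth_fDeriv (j : Fin 3 → ℤ) {G : UnitAddTorus (Fin 3) → ℝ} (hG : IsSmooth G) (i : Fin 3)
    {Φ : UnitAddTorus (Fin 4) → F} (hΦ : IsSmooth Φ) : IsSmooth (fDeriv j G i Φ) :=
  (ResidualTransfer.isSmooth_comp_slow (DissipationLaw.isSmooth_phaseGrad j hG i)).smul'
    (hΦ.partialDeriv (Fin.last 3))

/-- Linearity of the slow derivative: `∂_{xᵢ}(A + c B) = ∂_{xᵢ}A + c ∂_{xᵢ}B` for smooth `A`, `B`. [folklore] -/
theorem sDeriv_add_smul {A B : UnitAddTorus (Fin 4) → F} (hA : IsSmooth A) (hB : IsSmooth B) (c : ℝ)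
    (i : Fin 3) (y : UnitAddTorus (Fin 4)) :
    sDeriv i (fun y => A y + c • B y) y = sDeriv i A y + c • sDeriv i B y := by
  have hA1 : IsContDiff 1 A := hA.isContDiff (by simp)
  have hB1 : IsContDiff 1 B := hB.isContDiff (by simp)
  change partialDeriv i.castSucc (A + c • B) y = _
  rw [partialDeriv_add hA1 (hB1.smul c), partialDeriv_const_smul hB1]
  rfl

/-- Linearity of the weighted fast derivative: `kᵢ∂_θ(A + c B) = kᵢ∂_θA + c kᵢ∂_θB` (smooth `A`, `B`). [folklore] -/
theorem fDeriv_add_smul (j : Fin 3 → ℤ) (G : UnitAddTorus (Fin 3) → ℝ) {A B : UnitAddTorus (Fin 4) → F}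
    (hA : IsSmooth A) (hB : IsSmooth B) (c : ℝ) (i : Fin 3) (y : UnitAddTorus (Fin 4)) :
    fDeriv j G i (fun y => A y + c • B y) y = fDeriv j G i A y + c • fDeriv j G i B y := by
  have hA1 : IsContDiff 1 A := hA.isContDiff (by simp)
  have hB1 : IsContDiff 1 B := hB.isContDiff (by simp)
  change phaseGrad j G i (slow y) • partialDeriv (Fin.last 3) (A + c • B) y = _
  rw [partialDeriv_add hA1 (hB1.smul c), partialDeriv_const_smul hB1, Pi.add_apply, Pi.smul_apply, smul_add,
    smul_comm]
  rfl

/-- **Second-order two-scale Laplacian, mode by mode**: for smooth `Φ`,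
`∑ᵢ D^ε_i D^ε_i Φ = ∑ᵢ ∂ᵢ∂ᵢΦ + ε⁻¹ (∑ᵢ ∂ᵢ(kᵢ∂_θΦ) + ∑ᵢ kᵢ∂_θ∂ᵢΦ) + ε⁻² ∑ᵢ kᵢ∂_θ(kᵢ∂_θΦ)`, the mixed terms kept
as compositions (no product rule). [folklore] -/
theorem tsLaplacian_eq (ε : ℝ) (j : Fin 3 → ℤ) {G : UnitAddTorus (Fin 3) → ℝ} (hG : IsSmooth G)
    {Φ : UnitAddTorus (Fin 4) → F} (hΦ : IsSmooth Φ) (y : UnitAddTorus (Fin 4)) :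
    tsLaplacian ε j G Φ y =
      (∑ i : Fin 3, sDeriv i (sDeriv i Φ) y) +
        ε⁻¹ • (∑ i : Fin 3, (sDeriv i (fDeriv j G i Φ) y + fDeriv j G i (sDeriv i Φ) y)) +
        (ε⁻¹ * ε⁻¹) • ∑ i : Fin 3, fDeriv j G i (fDeriv j G i Φ) y := by
  simp only [tsLaplacian, Finset.smul_sum, ← Finset.sum_add_distrib]
  refine Finset.sum_congr rfl fun i _ => ?_
  have hfun : tsDeriv ε j G i Φ = fun y => sDeriv i Φ y + ε⁻¹ • fDeriv j G i Φ y :=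
    funext fun y => tsDeriv_eq ε j G i Φ y
  rw [hfun, tsDeriv_eq, sDeriv_add_smul (isSmooth_sDeriv hΦ i) (isSmooth_fDeriv j hG i hΦ),
    fDeriv_add_smul j G (isSmooth_sDeriv hΦ i) (isSmooth_fDeriv j hG i hΦ)]
  module

/-- **Two-scale convection, mode by mode**: `(Ψ · D^ε) Φ = ∑ₗ Ψₗ ∂ₗΦ + ε⁻¹ ∑ₗ Ψₗ kₗ∂_θΦ`. [folklore] -/
theorem tsConvect_eq (ε : ℝ) (j : Fin 3 → ℤ) (G : UnitAddTorus (Fin 3) → ℝ)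
    (Ψ : UnitAddTorus (Fin 4) → EuclideanSpace ℝ (Fin 3)) (Φ : UnitAddTorus (Fin 4) → F) (y : UnitAddTorus (Fin 4)) :
    tsConvect ε j G Ψ Φ y =
      (∑ l : Fin 3, (Ψ y) l • sDeriv l Φ y) + ε⁻¹ • ∑ l : Fin 3, (Ψ y) l • fDeriv j G l Φ y := by
  simp only [tsConvect, tsDeriv_eq, smul_add, Finset.sum_add_distrib, Finset.smul_sum, smul_smul]
  congr 1
  exact Finset.sum_congr rfl fun l _ => by rw [mul_comm]

/-! ## §3 Linearity of the two-scale operators over the ansatz `∑_{a ∈ T} ε^a Xₐ` -/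

section Ansatz

variable {X : ℕ → UnitAddTorus (Fin 4) → F}

/-- Truncated power sums of smooth profiles are smooth. [folklore] -/
theorem isSmooth_sum_pow_smul (hX : ∀ a, IsSmooth (X a)) (ε : ℝ) (T : Finset ℕ) :
    IsSmooth (fun y => ∑ a ∈ T, ε ^ a • X a y) := by
  have hl : Torus.lift (fun y => ∑ a ∈ T, ε ^ a • X a y) = fun z => ∑ a ∈ T, ε ^ a • Torus.lift (X a) z := rfl
  unfold IsSmooth
  rw [hl]
  exact ContDiff.sum fun a _ => (hX a).const_smul (ε ^ a)

/-- `∂ₘ ∑ ε^a Xₐ = ∑ ε^a ∂ₘ Xₐ` for smooth `Xₐ`. [folklore] -/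
theorem partialDeriv_sum_pow_smul (hX : ∀ a, IsSmooth (X a)) (ε : ℝ) (T : Finset ℕ) (m : Fin 4)
    (y : UnitAddTorus (Fin 4)) :
    partialDeriv m (fun y => ∑ a ∈ T, ε ^ a • X a y) y = ∑ a ∈ T, ε ^ a • partialDeriv m (X a) y := by
  have h1 : ∀ a, IsContDiff 1 (X a) := fun a => (hX a).isContDiff (by simp)
  rw [partialDeriv_finset_sum T (f := fun a y => ε ^ a • X a y) (fun a _ => (h1 a).smul (ε ^ a)) m y]
  exact Finset.sum_congr rfl fun a _ => congr_fun (partialDeriv_const_smul (h1 a) (ε ^ a) m) y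

/-- `sDeriv i ∑ ε^a Xₐ = ∑ ε^a sDeriv i Xₐ`. [folklore] -/
theorem sDeriv_sum (hX : ∀ a, IsSmooth (X a)) (ε : ℝ) (T : Finset ℕ) (i : Fin 3) (y : UnitAddTorus (Fin 4)) :
    sDeriv i (fun y => ∑ a ∈ T, ε ^ a • X a y) y = ∑ a ∈ T, ε ^ a • sDeriv i (X a) y :=
  partialDeriv_sum_pow_smul hX ε T i.castSucc y

/-- `fDeriv i ∑ ε^a Xₐ = ∑ ε^a fDeriv i Xₐ`. [folklore] -/
theorem fDeriv_sum (hX : ∀ a, IsSmooth (X a)) (ε : ℝ) (j : Fin 3 → ℤ) (G : UnitAddTorus (Fin 3) → ℝ)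
    (T : Finset ℕ) (i : Fin 3) (y : UnitAddTorus (Fin 4)) :
    fDeriv j G i (fun y => ∑ a ∈ T, ε ^ a • X a y) y = ∑ a ∈ T, ε ^ a • fDeriv j G i (X a) y := by
  unfold fDeriv
  rw [partialDeriv_sum_pow_smul hX, Finset.smul_sum]
  exact Finset.sum_congr rfl fun a _ => smul_comm _ _ _

/-- `D^ε_i ∑ ε^a Xₐ = ∑ ε^a D^ε_i Xₐ`. [folklore] -/
theorem tsDeriv_sum (hX : ∀ a, IsSmooth (X a)) (ε : ℝ) (j : Fin 3 → ℤ) (G : UnitAddTorus (Fin 3) → ℝ)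
    (T : Finset ℕ) (i : Fin 3) (y : UnitAddTorus (Fin 4)) :
    tsDeriv ε j G i (fun y => ∑ a ∈ T, ε ^ a • X a y) y = ∑ a ∈ T, ε ^ a • tsDeriv ε j G i (X a) y := by
  simp only [tsDeriv_eq, sDeriv_sum hX, fDeriv_sum hX, smul_add, Finset.sum_add_distrib, Finset.smul_sum]
  congr 1
  exact Finset.sum_congr rfl fun a _ => smul_comm _ _ _

/-- `∑ᵢ (D^ε_i)² ∑ ε^a Xₐ = ∑ ε^a ∑ᵢ (D^ε_i)² Xₐ` (linearity twice, the inner `D^ε_i Xₐ` being smooth). [folklore] -/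
theorem tsLaplacian_sum {G : UnitAddTorus (Fin 3) → ℝ} (hG : IsSmooth G) (hX : ∀ a, IsSmooth (X a)) (ε : ℝ)
    (j : Fin 3 → ℤ) (T : Finset ℕ) (y : UnitAddTorus (Fin 4)) :
    tsLaplacian ε j G (fun y => ∑ a ∈ T, ε ^ a • X a y) y = ∑ a ∈ T, ε ^ a • tsLaplacian ε j G (X a) y := by
  have h : ∀ i : Fin 3, tsDeriv ε j G i (tsDeriv ε j G i fun y => ∑ a ∈ T, ε ^ a • X a y) y =
      ∑ a ∈ T, ε ^ a • tsDeriv ε j G i (tsDeriv ε j G i (X a)) y := by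
    intro i
    have hfun : (tsDeriv ε j G i fun y => ∑ a ∈ T, ε ^ a • X a y) =
        fun y => ∑ a ∈ T, ε ^ a • tsDeriv ε j G i (X a) y :=
      funext fun y => tsDeriv_sum hX ε j G T i y
    rw [hfun]
    exact tsDeriv_sum (fun a => ResidualTransfer.isSmooth_tsDeriv ε j hG (hX a) i) ε j G T i y
  simp only [tsLaplacian, h, Finset.smul_sum]
  exact Finset.sum_comm

/-- `(Ψ · D^ε) ∑ ε^a Xₐ = ∑ ε^a (Ψ · D^ε) Xₐ`. [folklore] -/
theorem tsConvect_sum_right (hX : ∀ a, IsSmooth (X a)) (ε : ℝ) (j : Fin 3 → ℤ) (G : UnitAddTorus (Fin 3) → ℝ)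
    (T : Finset ℕ) (Ψ : UnitAddTorus (Fin 4) → EuclideanSpace ℝ (Fin 3)) (y : UnitAddTorus (Fin 4)) :
    tsConvect ε j G Ψ (fun y => ∑ a ∈ T, ε ^ a • X a y) y = ∑ a ∈ T, ε ^ a • tsConvect ε j G Ψ (X a) y := by
  simp only [tsConvect, tsDeriv_sum hX, Finset.smul_sum]
  rw [Finset.sum_comm]
  exact Finset.sum_congr rfl fun a _ => Finset.sum_congr rfl fun l _ => smul_comm _ _ _

end Ansatz

/-- `((∑ ε^a Pₐ) · D^ε) Φ = ∑ ε^a (Pₐ · D^ε) Φ` (pure algebra at the point). [folklore] -/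
theorem tsConvect_sum_left (ε : ℝ) (j : Fin 3 → ℤ) (G : UnitAddTorus (Fin 3) → ℝ) (T : Finset ℕ)
    (P : ℕ → UnitAddTorus (Fin 4) → EuclideanSpace ℝ (Fin 3)) (Φ : UnitAddTorus (Fin 4) → F)
    (y : UnitAddTorus (Fin 4)) :
    tsConvect ε j G (fun y => ∑ a ∈ T, ε ^ a • P a y) Φ y = ∑ a ∈ T, ε ^ a • tsConvect ε j G (P a) Φ y := by
  simp only [tsConvect, WithLp.ofLp_sum, Finset.sum_apply, PiLp.smul_apply, smul_eq_mul, Finset.sum_smul,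
    Finset.smul_sum, smul_smul]
  rw [Finset.sum_comm]

/-- Scalar version of `tsDeriv_sum`: `D^ε_i ∑ ε^a Θₐ = ∑ ε^a D^ε_i Θₐ` for smooth scalar `Θₐ`. [folklore] -/
theorem tsDeriv_sum_mul {Θ : ℕ → UnitAddTorus (Fin 4) → ℝ} (hΘ : ∀ a, IsSmooth (Θ a)) (ε : ℝ)
    (j : Fin 3 → ℤ) (G : UnitAddTorus (Fin 3) → ℝ) (T : Finset ℕ) (i : Fin 3) (y : UnitAddTorus (Fin 4)) :
    tsDeriv ε j G i (fun y => ∑ a ∈ T, ε ^ a * Θ a y) y = ∑ a ∈ T, ε ^ a * tsDeriv ε j G i (Θ a) y :=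
  tsDeriv_sum hΘ ε j G T i y

/-! ## §4 The five pieces of the residual, and the divergence, on the ansatz -/

section Pieces

variable (j : Fin 3 → ℤ) (N : ℕ) {P : ℕ → UnitAddTorus (Fin 4) → EuclideanSpace ℝ (Fin 3)}
  {Q : ℕ → UnitAddTorus (Fin 4) → ℝ}

/-- **Divergence**: `ε · tsDiv ε (∑ ε^a Pₐ) = ∑_{s < N+2} ε^s d_s`. [folklore] -/
theorem div_expansion {ε : ℝ} (hε : ε ≠ 0) (G : UnitAddTorus (Fin 3) → ℝ) (hP : ∀ a, IsSmooth (P a))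
    (y : UnitAddTorus (Fin 4)) :
    ε * tsDiv ε j G (fun y => ∑ a ∈ Finset.range (N + 1), ε ^ a • P a y) y =
      ∑ s ∈ Finset.range (N + 2), ε ^ s * divCoeff j G N P s y := by
  have hR : ∑ s ∈ Finset.range (N + 2), ε ^ s * divCoeff j G N P s y =
      ∑ a ∈ Finset.range (N + 1), ε ^ (a + 1) * ∑ i : Fin 3, (sDeriv i (P a) y) i +
        ∑ a ∈ Finset.range (N + 1), ε ^ a * ∑ i : Fin 3, (fDeriv j G i (P a) y) i := by
    simp only [divCoeff, Finset.sum_add_distrib, mul_add]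
    rw [sum_pow_mul_sum_ite ε _ (fun a => a + 1) _ ?h1, sum_pow_mul_sum_ite ε _ (fun a => a) _ ?h2]
    all_goals intro a ha; simp only [Finset.mem_range] at ha ⊢; omega
  rw [hR, tsDiv]
  simp only [tsDeriv_sum hP, WithLp.ofLp_sum, Finset.sum_apply, PiLp.smul_apply, smul_eq_mul, Finset.mul_sum,
    ← Finset.sum_add_distrib]
  rw [Finset.sum_comm]
  refine Finset.sum_congr rfl fun a _ => Finset.sum_congr rfl fun i _ => ?_
  rw [tsDeriv_eq, PiLp.add_apply, PiLp.smul_apply, smul_eq_mul]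
  field_simp
  ring

/-- **Convection**: `ε · ((∑ ε^a Pₐ) · D^ε)(∑ ε^b P_b) = ∑_s ε^s (convection block of M_s)`. [folklore] -/
theorem conv_expansion {ε : ℝ} (hε : ε ≠ 0) (G : UnitAddTorus (Fin 3) → ℝ) (hP : ∀ a, IsSmooth (P a))
    (y : UnitAddTorus (Fin 4)) :
    ε • tsConvect ε j G (fun y => ∑ a ∈ Finset.range (N + 1), ε ^ a • P a y)
        (fun y => ∑ a ∈ Finset.range (N + 1), ε ^ a • P a y) y =
      ∑ s ∈ Finset.range (2 * N + 4), ε ^ s • ∑ a ∈ Finset.range (N + 1), ∑ b ∈ Finset.range (N + 1),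
        ((if a + b + 1 = s then ∑ l : Fin 3, (P a y) l • sDeriv l (P b) y else 0) +
          (if a + b = s then ∑ l : Fin 3, (P a y) l • fDeriv j G l (P b) y else 0)) := by
  have hR : ∑ s ∈ Finset.range (2 * N + 4), ε ^ s • ∑ a ∈ Finset.range (N + 1), ∑ b ∈ Finset.range (N + 1),
        ((if a + b + 1 = s then ∑ l : Fin 3, (P a y) l • sDeriv l (P b) y else 0) +
          (if a + b = s then ∑ l : Fin 3, (P a y) l • fDeriv j G l (P b) y else 0)) =
      ∑ a ∈ Finset.range (N + 1), ∑ b ∈ Finset.range (N + 1),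
          ε ^ (a + b + 1) • ∑ l : Fin 3, (P a y) l • sDeriv l (P b) y +
        ∑ a ∈ Finset.range (N + 1), ∑ b ∈ Finset.range (N + 1),
          ε ^ (a + b) • ∑ l : Fin 3, (P a y) l • fDeriv j G l (P b) y := by
    simp only [Finset.sum_add_distrib, smul_add]
    rw [sum_pow_smul_sum_sum_ite ε _ (fun a b => a + b + 1) _ ?h1,
      sum_pow_smul_sum_sum_ite ε _ (fun a b => a + b) _ ?h2]
    all_goals intro a ha b hb; simp only [Finset.mem_range] at ha hb ⊢; omega
  rw [hR, tsConvect_sum_left]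
  simp only [tsConvect_sum_right hP, tsConvect_eq, smul_sum_range, ← sum_range_add]
  refine Finset.sum_congr rfl fun a _ => Finset.sum_congr rfl fun b _ => ?_
  match_scalars <;> (try field_simp) <;> ring

/-- **Viscosity**: `ε · ε² · ∑ᵢ (D^ε_i)² (∑ ε^a Pₐ) = ∑_s ε^s (viscous block of M_s)`. [folklore] -/
theorem lap_expansion (ε : ℝ) {G : UnitAddTorus (Fin 3) → ℝ} (hG : IsSmooth G) (hP : ∀ a, IsSmooth (P a))
    (y : UnitAddTorus (Fin 4)) :
    ε • (ε ^ 2 • tsLaplacian ε j G (fun y => ∑ a ∈ Finset.range (N + 1), ε ^ a • P a y) y) =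
      ∑ s ∈ Finset.range (2 * N + 4), ε ^ s • ∑ a ∈ Finset.range (N + 1),
        ((if a + 3 = s then ∑ i : Fin 3, sDeriv i (sDeriv i (P a)) y else 0) +
          (if a + 2 = s then ∑ i : Fin 3, (sDeriv i (fDeriv j G i (P a)) y + fDeriv j G i (sDeriv i (P a)) y)
            else 0) +
          (if a + 1 = s then ∑ i : Fin 3, fDeriv j G i (fDeriv j G i (P a)) y else 0)) := by
  have hR : ∑ s ∈ Finset.range (2 * N + 4), ε ^ s • ∑ a ∈ Finset.range (N + 1),
        ((if a + 3 = s then ∑ i : Fin 3, sDeriv i (sDeriv i (P a)) y else 0) +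
          (if a + 2 = s then ∑ i : Fin 3, (sDeriv i (fDeriv j G i (P a)) y + fDeriv j G i (sDeriv i (P a)) y)
            else 0) +
          (if a + 1 = s then ∑ i : Fin 3, fDeriv j G i (fDeriv j G i (P a)) y else 0)) =
      ∑ a ∈ Finset.range (N + 1), ε ^ (a + 3) • ∑ i : Fin 3, sDeriv i (sDeriv i (P a)) y +
        ∑ a ∈ Finset.range (N + 1),
          ε ^ (a + 2) • ∑ i : Fin 3, (sDeriv i (fDeriv j G i (P a)) y + fDeriv j G i (sDeriv i (P a)) y) +
        ∑ a ∈ Finset.range (N + 1), ε ^ (a + 1) • ∑ i : Fin 3, fDeriv j G i (fDeriv j G i (P a)) y := by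
    simp only [sum_range_add, smul_add]
    rw [sum_pow_smul_sum_ite ε _ (fun a => a + 3) _ ?h1, sum_pow_smul_sum_ite ε _ (fun a => a + 2) _ ?h2,
      sum_pow_smul_sum_ite ε _ (fun a => a + 1) _ ?h3]
    all_goals intro a ha; simp only [Finset.mem_range] at ha ⊢; omega
  rw [hR, tsLaplacian_sum hG hP, smul_smul]
  simp only [smul_sum_range, tsLaplacian_eq ε j hG (hP _), ← sum_range_add]
  refine Finset.sum_congr rfl fun a _ => ?_
  match_scalars <;> (try field_simp) <;> ring

/-- **Pressure**: `ε · D^ε(∑ ε^a Qₐ) = ∑_s ε^s (pressure block of M_s)`. [folklore] -/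
theorem grad_expansion {ε : ℝ} (hε : ε ≠ 0) (G : UnitAddTorus (Fin 3) → ℝ) (hQ : ∀ a, IsSmooth (Q a))
    (y : UnitAddTorus (Fin 4)) :
    ε • tsGrad ε j G (fun y => ∑ a ∈ Finset.range (N + 1), ε ^ a * Q a y) y =
      ∑ s ∈ Finset.range (2 * N + 4), ε ^ s • ∑ a ∈ Finset.range (N + 1),
        WithLp.toLp 2 (fun i : Fin 3 =>
          (if a + 1 = s then sDeriv i (Q a) y else 0) + (if a = s then fDeriv j G i (Q a) y else 0)) := by
  ext i
  simp only [tsGrad, PiLp.smul_apply, WithLp.ofLp_sum, Finset.sum_apply, smul_eq_mul,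
    Finset.sum_add_distrib, mul_add]
  rw [tsDeriv_sum_mul hQ, sum_pow_mul_sum_ite ε _ (fun a => a + 1) _ ?h1,
    sum_pow_mul_sum_ite ε _ (fun a => a) _ ?h2]
  · rw [Finset.mul_sum, ← Finset.sum_add_distrib]
    refine Finset.sum_congr rfl fun a _ => ?_
    rw [tsDeriv_eq, smul_eq_mul]
    field_simp
    ring
  all_goals intro a ha; simp only [Finset.mem_range] at ha ⊢; omega

/-- **Drift**: `ε · (∑ ε^a cₐ) D^ε_2 (∑ ε^b P_b) = ∑_s ε^s (drift block of M_s)`. [folklore] -/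
theorem drift_expansion {ε : ℝ} (hε : ε ≠ 0) (G : UnitAddTorus (Fin 3) → ℝ) (hP : ∀ a, IsSmooth (P a))
    (c : ℕ → ℝ) (y : UnitAddTorus (Fin 4)) :
    ε • ((∑ a ∈ Finset.range (N + 1), ε ^ a * c a) •
        tsDeriv ε j G 2 (fun y => ∑ a ∈ Finset.range (N + 1), ε ^ a • P a y) y) =
      ∑ s ∈ Finset.range (2 * N + 4), ε ^ s • ∑ a ∈ Finset.range (N + 1), ∑ b ∈ Finset.range (N + 1),
        ((if a + b + 1 = s then c a • sDeriv 2 (P b) y else 0) +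
          (if a + b = s then c a • fDeriv j G 2 (P b) y else 0)) := by
  have hR : ∑ s ∈ Finset.range (2 * N + 4), ε ^ s • ∑ a ∈ Finset.range (N + 1), ∑ b ∈ Finset.range (N + 1),
        ((if a + b + 1 = s then c a • sDeriv 2 (P b) y else 0) +
          (if a + b = s then c a • fDeriv j G 2 (P b) y else 0)) =
      ∑ a ∈ Finset.range (N + 1), ∑ b ∈ Finset.range (N + 1), ε ^ (a + b + 1) • c a • sDeriv 2 (P b) y +
        ∑ a ∈ Finset.range (N + 1), ∑ b ∈ Finset.range (N + 1), ε ^ (a + b) • c a • fDeriv j G 2 (P b) y := by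
    simp only [Finset.sum_add_distrib, smul_add]
    rw [sum_pow_smul_sum_sum_ite ε _ (fun a b => a + b + 1) _ ?h1,
      sum_pow_smul_sum_sum_ite ε _ (fun a b => a + b) _ ?h2]
    all_goals intro a ha b hb; simp only [Finset.mem_range] at ha hb ⊢; omega
  rw [hR, tsDeriv_sum hP, Finset.sum_smul, Finset.smul_sum]
  simp only [Finset.smul_sum, ← Finset.sum_add_distrib]
  refine Finset.sum_congr rfl fun a _ => Finset.sum_congr rfl fun b _ => ?_
  rw [tsDeriv_eq]
  match_scalars <;> (try field_simp) <;> ring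

/-- **Force**: `ε · f(x) = ∑_s ε^s [s = 1] f(x)`. [folklore] -/
theorem force_expansion (ε : ℝ) (v : EuclideanSpace ℝ (Fin 3)) :
    ε • v = ∑ s ∈ Finset.range (2 * N + 4), ε ^ s • (if s = 1 then v else 0) := by
  simp_rw [smul_ite, smul_zero]
  rw [Finset.sum_ite_eq', if_pos (Finset.mem_range.2 (by omega)), pow_one]

end Pieces

/-! ## §5 The registered stub -/

/-- **stub_formalExpansionW** (formal Laurent expansion on the polynomial ansatz; the registered signature,
verbatim).  For smooth `G`, `Pₐ`, `Qₐ`: the truncated sums `∑_{a ≤ N} ε^a Pₐ`, `∑_{a ≤ N} ε^a Qₐ` are smooth,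
`∂ₘ` commutes with them, and for `ε ≠ 0` the two-scale divergence and steady residual on the ansatz are the
Laurent polynomials `ε · tsDiv = ∑_{s < N+2} ε^s d_s`, `ε · tsResidual = ∑_{s < 2N+4} ε^s M_s` with the ε-free
coefficient profiles `d_s = divCoeff … s`, `M_s = hierarchyCoeff … s`. [folklore] -/
theorem stub_formalExpansionW : ∀ (j : Fin 3 → ℤ) (G : UnitAddTorus (Fin 3) → ℝ) (f : UnitAddTorus (Fin 3) → EuclideanSpace ℝ (Fin 3)) (N : ℕ) (P : ℕ → UnitAddTorus (Fin 4) → EuclideanSpace ℝ (Fin 3)) (Q : ℕ → UnitAddTorus (Fin 4) → ℝ) (c : ℕ → ℝ) (ε : ℝ), Literature.Analysis.FunctionSpaces.Torus.IsSmooth G → (∀ a, Literature.Analysis.FunctionSpaces.Torus.IsSmooth (P a)) → (∀ a, Literature.Analysis.FunctionSpaces.Torus.IsSmooth (Q a)) → Literature.Analysis.FunctionSpaces.Torus.IsSmooth (fun y => ∑ a ∈ Finset.range (N + 1), ε ^ a • P a y) ∧ Literature.Analysis.FunctionSpaces.Torus.IsSmooth (fun y => ∑ a ∈ Finset.range (N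 + 1), ε ^ a * Q a y) ∧ (∀ (m : Fin 4) (y : UnitAddTorus (Fin 4)), Literature.Analysis.FunctionSpaces.Torus.partialDeriv m (fun y => ∑ a ∈ Finset.range (N + 1), ε ^ a • P a y) y = ∑ a ∈ Finset.range (N + 1), ε ^ a • Literature.Analysis.FunctionSpaces.Torus.partialDeriv m (P a) y) ∧ (ε ≠ 0 → ∀ y : UnitAddTorus (Fin 4), ε * tsDiv ε j G (fun y => ∑ a ∈ Finset.range (N + 1), ε ^ a • P a y) y = ∑ s ∈ Finset.range (N + 2), ε ^ s * divCoeff j G N P s y ∧ ε • tsResidual ε j G f (fun y => ∑ a ∈ Finset.range (N + 1), ε ^ a • P a y) (fun y => ∑ a ∈ Finset.range (N + 1), ε ^ a * Q a y) (∑ a ∈ Finset.range (N + 1), ε ^ a * c a) y = ∑ s ∈ Finset.range (2 * N + 4), ε ^ s • hierarchyCoeff j G f N P Q c s y) := by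
  intro j G f N P Q c ε hG hP hQ
  refine ⟨isSmooth_sum_pow_smul hP ε _, isSmooth_sum_pow_smul hQ ε _,
    fun m y => partialDeriv_sum_pow_smul hP ε _ m y, fun hε y => ⟨div_expansion j N hε G hP y, ?_⟩⟩
  simp only [tsResidual, smul_sub, smul_add]
  rw [conv_expansion j N hε G hP y, lap_expansion j N ε hG hP y, grad_expansion j N hε G hQ y,
    drift_expansion j N hε G hP c y, force_expansion N ε (f (slow y))]
  simp only [hierarchyCoeff, smul_sub, smul_add, Finset.sum_sub_distrib, Finset.sum_add_distrib]

end Summit.AnomalousDissipation.AnomalousDissipation.Theorems.TaylorWaveQuasiSteady.FormalExpansion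

end
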